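import Summits.CriticalPhenomena.PercolationContinuityZ3.Theorems.Transplant.FKConnectivityAllQPat3MinorAllInner
import Summits.CriticalPhenomena.PercolationContinuityZ3.Theorems.Transplant.FKConnectivityAllQPat3SPConjecture
import HarnessLib

/-!
# Connectivity correlation inequalities for `φ_{w,q}`, every `q > 0` — **THEOREM SP ON EVERY MINOR OF EVERY TWO-TERMINAL SERIES–PARALLEL NETWORK**

Proof file (`--supports stmt-CriticalPhenomena-4575`), census lineage (gen 37) of LANE 2's FK sub-programme; builds on p205010
(kernel theorem, internal audit signed; external expert review pending).  No definitions, no named facts, no sorries.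

**`FK.spGoodC_of_isTTSP`** — census g37's THEOREM SP (`FK.spGood_of_isTTSP`, `…Pat3TheoremSP.lean`) on MINORS: for a
two-terminal series–parallel network `N` (`FK.IsTTSP N x y`), every free set `E ⊆ N`, every contracted set `C ⊆ N` and every
three pairwise distinct vertices `b, s, t` on `N`, the levelwise `T_sym` and the three `STAR`s of the minor `(E, C)` are
nonnegative (`FK.SPGoodC E C b s t`; deletion is the restriction `E ⊆ N`, contraction the set `C`, so EVERY minor of `N` is
covered).  Same induction as the plain theorem (series: `FK.spGoodC_series`; parallel: `FK.spGoodC_parallel`), the minor riding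
along.  Corollaries: the weight forms (`FK.mval2C_nonneg_of_lev2C`, `FK.tvalC_tsym_nonneg_of_isTTSP`,
`FK.mval2C_star_nonneg_of_isTTSP`) and **Conjecture T on every minor of a two-terminal series–parallel network, every placement**
(`FK.antipodalT_nonneg_of_isTTSP_minor`: `0 ≤ antipodalT q b s t F C` for `F, C ⊆ N`, every `q > 0`), via `FK.antipodalT_nonneg_of_spGoodC`
(`…Pat3SPConjecture.lean`: `antipodalT q z s t F C = tvalC (q^·) F C z s t T(apex)`, `T(apex) ≥ T_sym`).  This is the input of the measure-level
statement `δ_w(b; s, t) ≥ 0` for every weight vector supported on `N` (`…Pat3DeltaSP.lean`).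
[cite: AyyerLinussonRavichandran2025, §7 eq. (13)–(15) (p. 22)] [cite: Grimmett2006, §3.8 (pp. 61–62)]
-/

namespace Summit.CriticalPhenomena.PercolationContinuityZ3.Theorems

namespace FK

open SimpleGraph Literature.Probability.LatticeModels Literature.Probability.Percolation
open scoped Classical

variable {V : Type*} [Fintype V]

/-! ### The series case on minors (uses the induction hypothesis on the blocks) -/

section SeriesCaseC

variable {F₁ F₂ : Finset (Sym2 V)} {x m y : V} {E C : Finset (Sym2 V)}

/-- Series case on minors, a mark at the junction `m`. [cite: AyyerLinussonRavichandran2025, §7 (p. 22)] -/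
theorem serC_junction {p q : V} (hF₁ : IsTTSP F₁ x m) (hF₂ : IsTTSP F₂ m y) (hdF : Disjoint F₁ F₂)
    (hVF : ∀ z : V, (∃ e ∈ F₁, z ∈ e) → (∃ e ∈ F₂, z ∈ e) → z = m)
    (ih₁ : ∀ {E' C' : Finset (Sym2 V)} {b s t : V}, E' ⊆ F₁ → C' ⊆ F₁ → (∃ e ∈ F₁, b ∈ e) → (∃ e ∈ F₁, s ∈ e) →
      (∃ e ∈ F₁, t ∈ e) → b ≠ s → b ≠ t → s ≠ t → SPGoodC E' C' b s t)
    (ih₂ : ∀ {E' C' : Finset (Sym2 V)} {b s t : V}, E' ⊆ F₂ → C' ⊆ F₂ → (∃ e ∈ F₂, b ∈ e) → (∃ e ∈ F₂, s ∈ e) →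
      (∃ e ∈ F₂, t ∈ e) → b ≠ s → b ≠ t → s ≠ t → SPGoodC E' C' b s t)
    (hE : E ⊆ F₁ ∪ F₂) (hC : C ⊆ F₁ ∪ F₂)
    (hp : ∃ e ∈ F₁ ∪ F₂, p ∈ e) (hq : ∃ e ∈ F₁ ∪ F₂, q ∈ e) (hpm : p ≠ m) (hqm : q ≠ m) (hpq : p ≠ q) :
    SPGoodC E C m p q := by
  have iE : ∀ A : Finset (Sym2 V), E ∩ A ⊆ A := fun A => Finset.inter_subset_right
  have iC : ∀ A : Finset (Sym2 V), C ∩ A ⊆ A := fun A => Finset.inter_subset_right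
  have hVF' : ∀ z : V, (∃ e ∈ F₂, z ∈ e) → (∃ e ∈ F₁, z ∈ e) → z = m := fun z h2 h1 => hVF z h1 h2
  have eB : F₁ ∪ F₂ = F₂ ∪ F₁ := Finset.union_comm _ _
  rcases span_union hp with hp1 | hp2 <;> rcases span_union hq with hq1 | hq2
  · exact (spGoodC_oneSided hdF hVF (iE _) (iC _) (iE _) (iC _) hF₁.right_mem hp1 hq1 (Ne.symm hpm) (Ne.symm hqm) hpq
      (ih₁ (iE _) (iC _) hF₁.right_mem hp1 hq1 (Ne.symm hpm) (Ne.symm hqm) hpq)).congr_sets (inter_union2_eq hE rfl)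
      (inter_union2_eq hC rfl)
  · exact (spGoodC_cutS hdF hVF (iE _) (iC _) (iE _) (iC _) hp1 hq2 hpm hqm).rotate'.congr_sets (inter_union2_eq hE rfl)
      (inter_union2_eq hC rfl)
  · exact (spGoodC_cutS hdF hVF (iE _) (iC _) (iE _) (iC _) hq1 hp2 hqm hpm).swap13.congr_sets (inter_union2_eq hE rfl)
      (inter_union2_eq hC rfl)
  · exact (spGoodC_oneSided hdF.symm hVF' (iE _) (iC _) (iE _) (iC _) hF₂.left_mem hp2 hq2 (Ne.symm hpm) (Ne.symm hqm)
      hpq (ih₂ (iE _) (iC _) hF₂.left_mem hp2 hq2 (Ne.symm hpm) (Ne.symm hqm) hpq)).congr_sets (inter_union2_eq hE eB)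
      (inter_union2_eq hC eB)

/-- Series case on minors, junction unmarked, marks `p, q` on the first block and `r` on the second.
[cite: AyyerLinussonRavichandran2025, §7 (p. 22)] -/
theorem serC_cut1 {p q r : V} (hF₁ : IsTTSP F₁ x m) (hdF : Disjoint F₁ F₂)
    (hVF : ∀ z : V, (∃ e ∈ F₁, z ∈ e) → (∃ e ∈ F₂, z ∈ e) → z = m)
    (ih₁ : ∀ {E' C' : Finset (Sym2 V)} {b s t : V}, E' ⊆ F₁ → C' ⊆ F₁ → (∃ e ∈ F₁, b ∈ e) → (∃ e ∈ F₁, s ∈ e) →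
      (∃ e ∈ F₁, t ∈ e) → b ≠ s → b ≠ t → s ≠ t → SPGoodC E' C' b s t)
    (hE : E ⊆ F₁ ∪ F₂) (hC : C ⊆ F₁ ∪ F₂)
    (hp : ∃ e ∈ F₁, p ∈ e) (hq : ∃ e ∈ F₁, q ∈ e) (hr : ∃ e ∈ F₂, r ∈ e) (hpm : p ≠ m) (hqm : q ≠ m) (hrm : r ≠ m)
    (hpq : p ≠ q) : SPGoodC E C p r q := by
  have iE : ∀ A : Finset (Sym2 V), E ∩ A ⊆ A := fun A => Finset.inter_subset_right
  have iC : ∀ A : Finset (Sym2 V), C ∩ A ⊆ A := fun A => Finset.inter_subset_right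
  exact (spGoodC_cut1 hdF hVF (iE _) (iC _) (iE _) (iC _) hp hq hr hpm hqm hrm
    (ih₁ (iE _) (iC _) hp hF₁.right_mem hq hpm hpq (Ne.symm hqm))).congr_sets (inter_union2_eq hE rfl) (inter_union2_eq hC rfl)

/-- **THE SERIES CASE ON MINORS.** [cite: AyyerLinussonRavichandran2025, §7 (p. 22)] -/
theorem spGoodC_series {b s t : V} (hF₁ : IsTTSP F₁ x m) (hF₂ : IsTTSP F₂ m y) (hdF : Disjoint F₁ F₂)
    (hVF : ∀ z : V, (∃ e ∈ F₁, z ∈ e) → (∃ e ∈ F₂, z ∈ e) → z = m)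
    (ih₁ : ∀ {E' C' : Finset (Sym2 V)} {b s t : V}, E' ⊆ F₁ → C' ⊆ F₁ → (∃ e ∈ F₁, b ∈ e) → (∃ e ∈ F₁, s ∈ e) →
      (∃ e ∈ F₁, t ∈ e) → b ≠ s → b ≠ t → s ≠ t → SPGoodC E' C' b s t)
    (ih₂ : ∀ {E' C' : Finset (Sym2 V)} {b s t : V}, E' ⊆ F₂ → C' ⊆ F₂ → (∃ e ∈ F₂, b ∈ e) → (∃ e ∈ F₂, s ∈ e) →
      (∃ e ∈ F₂, t ∈ e) → b ≠ s → b ≠ t → s ≠ t → SPGoodC E' C' b s t)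
    (hE : E ⊆ F₁ ∪ F₂) (hC : C ⊆ F₁ ∪ F₂)
    (hb : ∃ e ∈ F₁ ∪ F₂, b ∈ e) (hs : ∃ e ∈ F₁ ∪ F₂, s ∈ e) (ht : ∃ e ∈ F₁ ∪ F₂, t ∈ e)
    (hbs : b ≠ s) (hbt : b ≠ t) (hst : s ≠ t) : SPGoodC E C b s t := by
  by_cases hbm : b = m
  · subst hbm
    exact serC_junction hF₁ hF₂ hdF hVF ih₁ ih₂ hE hC hs ht (Ne.symm hbs) (Ne.symm hbt) hst
  by_cases hsm : s = m
  · subst hsm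
    exact (serC_junction hF₁ hF₂ hdF hVF ih₁ ih₂ hE hC hb ht hbs (Ne.symm hst) hbt).swap12
  by_cases htm : t = m
  · subst htm
    exact (serC_junction hF₁ hF₂ hdF hVF ih₁ ih₂ hE hC hb hs hbt hst hbs).rotate
  have iE : ∀ A : Finset (Sym2 V), E ∩ A ⊆ A := fun A => Finset.inter_subset_right
  have iC : ∀ A : Finset (Sym2 V), C ∩ A ⊆ A := fun A => Finset.inter_subset_right
  have hVF' : ∀ z : V, (∃ e ∈ F₂, z ∈ e) → (∃ e ∈ F₁, z ∈ e) → z = m := fun z h2 h1 => hVF z h1 h2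
  have eB : F₁ ∪ F₂ = F₂ ∪ F₁ := Finset.union_comm _ _
  have hEB := eB ▸ hE; have hCB := eB ▸ hC
  rcases span_union hb with hb1 | hb2 <;> rcases span_union hs with hs1 | hs2 <;> rcases span_union ht with ht1 | ht2
  · exact (spGoodC_oneSided hdF hVF (iE _) (iC _) (iE _) (iC _) hb1 hs1 ht1 hbs hbt hst
      (ih₁ (iE _) (iC _) hb1 hs1 ht1 hbs hbt hst)).congr_sets (inter_union2_eq hE rfl) (inter_union2_eq hC rfl)
  · exact (serC_cut1 hF₁ hdF hVF ih₁ hE hC hb1 hs1 ht2 hbm hsm htm hbs).swap23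
  · exact serC_cut1 hF₁ hdF hVF ih₁ hE hC hb1 ht1 hs2 hbm htm hsm hbt
  · exact (serC_cut1 hF₂.symm hdF.symm hVF' ih₂ hEB hCB hs2 ht2 hb1 hsm htm hbm hst).swap12
  · exact (serC_cut1 hF₁ hdF hVF ih₁ hE hC hs1 ht1 hb2 hsm htm hbm hst).swap12
  · exact serC_cut1 hF₂.symm hdF.symm hVF' ih₂ hEB hCB hb2 ht2 hs1 hbm htm hsm hbt
  · exact (serC_cut1 hF₂.symm hdF.symm hVF' ih₂ hEB hCB hb2 hs2 ht1 hbm hsm htm hbs).swap23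
  · exact (spGoodC_oneSided hdF.symm hVF' (iE _) (iC _) (iE _) (iC _) hb2 hs2 ht2 hbs hbt hst
      (ih₂ (iE _) (iC _) hb2 hs2 ht2 hbs hbt hst)).congr_sets (inter_union2_eq hE eB) (inter_union2_eq hC eB)

end SeriesCaseC

/-! ### THEOREM SP on minors -/

section MainC

/-- THEOREM SP on minors by strong induction on the number of edges of the network (auxiliary form with an explicit bound).
[cite: AyyerLinussonRavichandran2025, §7 (p. 22)] -/
theorem spGoodC_of_isTTSP_aux : ∀ (n : ℕ) {N E C : Finset (Sym2 V)} {x y b s t : V}, N.card ≤ n → IsTTSP N x y →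
    E ⊆ N → C ⊆ N → (∃ e ∈ N, b ∈ e) → (∃ e ∈ N, s ∈ e) → (∃ e ∈ N, t ∈ e) → b ≠ s → b ≠ t → s ≠ t →
    SPGoodC E C b s t := by
  intro n
  induction n with
  | zero =>
    intro N E C x y b s t hcard hN _ _ _ _ _ _ _ _
    have := hN.card_pos
    omega
  | succ n ih =>
    intro N E C x y b s t hcard hN hE hC hb hs ht hbs hbt hst
    cases hN with
    | edge hxy =>
      have key : ∀ p : V, (∃ e ∈ ({s(x, y)} : Finset (Sym2 V)), p ∈ e) → p = x ∨ p = y := fun p ⟨e, he, hpe⟩ => by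
        rw [Finset.mem_singleton] at he
        subst he
        exact Sym2.mem_iff.1 hpe
      rcases key b hb with hb' | hb' <;> rcases key s hs with hs' | hs' <;> rcases key t ht with ht' | ht'
      all_goals first
        | exact absurd (hb'.trans hs'.symm) hbs
        | exact absurd (hb'.trans ht'.symm) hbt
        | exact absurd (hs'.trans ht'.symm) hst
    | @parallel Q₁ Q₂ _ _ hQ₁ hQ₂ hdQ hVQ => exact spGoodC_parallel hQ₁ hQ₂ hdQ hVQ hE hC hb hs ht hbs hbt hst
    | @series F₁ F₂ _ m _ hF₁ hF₂ hdF hVF hxF₂ hyF₁ =>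
      have hlt1 := card_left_lt_of_parallel hF₂ hdF
      have hlt2 := card_right_lt_of_parallel hF₁ hdF
      exact spGoodC_series hF₁ hF₂ hdF hVF
        (fun hE' hC' hb' hs' ht' hbs' hbt' hst' => ih (by omega) hF₁ hE' hC' hb' hs' ht' hbs' hbt' hst')
        (fun hE' hC' hb' hs' ht' hbs' hbt' hst' => ih (by omega) hF₂ hE' hC' hb' hs' ht' hbs' hbt' hst') hE hC hb hs ht
        hbs hbt hst

/-- **THEOREM SP ON EVERY MINOR OF A TWO-TERMINAL SERIES–PARALLEL NETWORK, EVERY PLACEMENT** (census g37): for a two-terminal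
series–parallel network `N`, any `E, C ⊆ N` (free / contracted) and ANY three pairwise distinct vertices `b, s, t` on `N`,
`T_sym(b,s,t) ≥ 0` and `STAR(b;s,t), STAR(s;b,t), STAR(t;b,s) ≥ 0` on the minor `(E, C)` at every level.
[cite: AyyerLinussonRavichandran2025, §7 (p. 22)] -/
theorem spGoodC_of_isTTSP {N E C : Finset (Sym2 V)} {x y b s t : V} (hN : IsTTSP N x y) (hE : E ⊆ N) (hC : C ⊆ N)
    (hb : ∃ e ∈ N, b ∈ e) (hs : ∃ e ∈ N, s ∈ e) (ht : ∃ e ∈ N, t ∈ e) (hbs : b ≠ s) (hbt : b ≠ t) (hst : s ≠ t) :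
    SPGoodC E C b s t :=
  spGoodC_of_isTTSP_aux N.card le_rfl hN hE hC hb hs ht hbs hbt hst

/-- **THEOREM SP on minors, levelwise form spelled out.** [cite: AyyerLinussonRavichandran2025, §7 (p. 22)] -/
theorem spC_levelwise_nonneg {N E C : Finset (Sym2 V)} {x y b s t : V} (hN : IsTTSP N x y) (hE : E ⊆ N) (hC : C ⊆ N)
    (hb : ∃ e ∈ N, b ∈ e) (hs : ∃ e ∈ N, s ∈ e) (ht : ∃ e ∈ N, t ∈ e) (hbs : b ≠ s) (hbt : b ≠ t) (hst : s ≠ t) (μ : ℕ) :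
    0 ≤ lev2C E C b s t tsym2Tab μ ∧ 0 ≤ lev2C E C b s t starXTab μ ∧ 0 ≤ lev2C E C b s t (mirror2 starXTab) μ ∧
      0 ≤ lev2C E C b s t starSTab μ :=
  spGoodC_of_isTTSP hN hE hC hb hs ht hbs hbt hst μ

end MainC

/-! ### Weight forms on minors -/



section WeightFormsC

/-- **THEOREM SP on minors, weight form for `T_sym`**: `0 ≤ tvalC w E C b s t T_sym` for every nonnegative level weight.
[cite: AyyerLinussonRavichandran2025, §7 (p. 22)] -/
theorem tvalC_tsym_nonneg_of_isTTSP {N E C : Finset (Sym2 V)} {x y b s t : V} (hN : IsTTSP N x y) (hE : E ⊆ N) (hC : C ⊆ N)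
    (hb : ∃ e ∈ N, b ∈ e) (hs : ∃ e ∈ N, s ∈ e) (ht : ∃ e ∈ N, t ∈ e) (hbs : b ≠ s) (hbt : b ≠ t) (hst : s ≠ t)
    {w : ℕ → ℝ} (hw : ∀ n, 0 ≤ w n) : 0 ≤ tvalC w E C b s t tsymTab := by
  have h := mval2C_nonneg_of_lev2C (fun μ => (spGoodC_of_isTTSP hN hE hC hb hs ht hbs hbt hst μ).1) hw
  rw [mval2C_tsym2Tab] at h
  linarith

/-- **THEOREM SP on minors, weight form for `STAR`** (apex = the first listed mark). [cite: AyyerLinussonRavichandran2025, §7 (p. 22)] -/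
theorem mval2C_star_nonneg_of_isTTSP {N E C : Finset (Sym2 V)} {x y b s t : V} (hN : IsTTSP N x y) (hE : E ⊆ N)
    (hC : C ⊆ N) (hb : ∃ e ∈ N, b ∈ e) (hs : ∃ e ∈ N, s ∈ e) (ht : ∃ e ∈ N, t ∈ e) (hbs : b ≠ s) (hbt : b ≠ t)
    (hst : s ≠ t) {w : ℕ → ℝ} (hw : ∀ n, 0 ≤ w n) : 0 ≤ mval2C w E C b s t starXTab :=
  mval2C_nonneg_of_lev2C (fun μ => (spGoodC_of_isTTSP hN hE hC hb hs ht hbs hbt hst μ).2.1) hw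

end WeightFormsC

/-! ### Conjecture T on every minor of a two-terminal series–parallel network -/

section AntipodalC

/-- **NEW KERNEL ROW (census g37): CONJECTURE T ON EVERY MINOR OF EVERY TWO-TERMINAL SERIES–PARALLEL NETWORK, EVERY PLACEMENT.**
For `q > 0`, a two-terminal series–parallel network `N`, any `F, C ⊆ N` and any three pairwise distinct vertices `b, s, t` on `N`:
`0 ≤ antipodalT q b s t F C` — `AntipodalTPos`'s functional on the minor "keep `F` free, contract `C`, delete the rest".
(fk-2's `FK.antipodalT_nonneg_of_isTTSP`: pair = the two terminals; census g37's `FK.antipodalT_nonneg_of_isTTSP_marks`: `C = ∅`.)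
[cite: AyyerLinussonRavichandran2025, §7 eq. (13)–(15) (p. 22)] -/
theorem antipodalT_nonneg_of_isTTSP_minor {q : ℝ} (hq : 0 < q) {N F C : Finset (Sym2 V)} {x y b s t : V} (hN : IsTTSP N x y)
    (hF : F ⊆ N) (hC : C ⊆ N) (hb : ∃ e ∈ N, b ∈ e) (hs : ∃ e ∈ N, s ∈ e) (ht : ∃ e ∈ N, t ∈ e) (hbs : b ≠ s)
    (hbt : b ≠ t) (hst : s ≠ t) : 0 ≤ antipodalT q b s t (↑F : BondConfig V) (↑C : BondConfig V) :=
  antipodalT_nonneg_of_spGoodC hq (spGoodC_of_isTTSP hN hF hC hb hs ht hbs hbt hst)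

/-- **THEOREM SP discharges CONJECTURE SP on the two-terminal series–parallel class**: the `Fin n` clause of `FK.SPGoodPos` for
minors of a TTSP network with the marks on it. [cite: AyyerLinussonRavichandran2025, §7 (p. 22)] -/
theorem spGoodPos_clause_of_isTTSP {n : ℕ} {N E C : Finset (Sym2 (Fin n))} {x y b s t : Fin n} (hN : IsTTSP N x y) (hE : E ⊆ N)
    (hC : C ⊆ N) (hb : ∃ e ∈ N, b ∈ e) (hs : ∃ e ∈ N, s ∈ e) (ht : ∃ e ∈ N, t ∈ e) (hbs : b ≠ s) (hbt : b ≠ t) (hst : s ≠ t) :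
    SPGoodC E C b s t :=
  spGoodC_of_isTTSP hN hE hC hb hs ht hbs hbt hst

end AntipodalC

end FK

end Summit.CriticalPhenomena.PercolationContinuityZ3.Theorems
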